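import Mathlib
import HarnessLib
import HarnessLib.Audit
import Summits.AtomisticToContinuum.Statement
import Literature.MathematicalPhysics.QuantumManyBody.PeriodicBoseGas
import Literature.MathematicalPhysics.QuantumManyBody.BoseGasThermodynamicLimitRuelle
import Summits.AtomisticToContinuum.BoseEinsteinCondensation.Theorems.BECFeynmanVortexAreaBornRepresentativesExist
import Summits.AtomisticToContinuum.BoseEinsteinCondensation.Theorems.BECInfraredBoundBecFreeGas

/-!
Route: BECEqualScatteringTransfer

DORMANT since 2026-09-03T10:19:02Z (reconciler: no traction for 5 d (last activity statement-checked at 2026-08-29T09:16:14Z); parked, not closed — `ledger route dormant route-AtomisticToContinuum-BECEqualScatteringTransfer --off` to re) — unstaffed, not closed; items shared with open routes are served there. `ledger route dormant <id> --off` reactivates.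

# Route BECEqualScatteringTransfer — equal scattering length, equal condensation — transfer dilute
BEC along equal-a pairs, prove it for one bounded representative per a

X = X_T ∧ X_R ("it suffices to show"); conforming re-open (D-0027 §2.1) of route
EqualScatteringTransfer (retired 2026-08-15T13:42Z: its assembly named the Literature constant),
realising card equal-scattering-length-transfer (spine).
X_T = ScatteringLengthTransfer (SCATTERING-LENGTH TRANSFER, shared verbatim with
stmt-AtomisticToContinuum-9048): for admissible (repulsive, measurable, finite-range) radial
profiles v, w with v BOUNDED and scatteringLength v = scatteringLength w, ground-state BEC at all
small densities for v implies the same for w (w arbitrary admissible: hard cores allowed).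
X_R = RepresentativeBEC (REPRESENTATIVE BEC): for every real a ≥ 0 SOME bounded admissible v with
scatteringLength v = a has ground-state BEC at all small densities.
Finite range forces scatteringLength w < ⊤ (PROVED in the tree:
IsRepulsiveFiniteRange.scatteringLength_ne_top), so X_T ∧ X_R decides the conjunct for every w: the
∀v of BoseEinsteinCondensation collapses to ONE bounded representative per value of a. The
quantitative heart (card T1 in typable dress) is the rank-2 crux CondensateComparison, a
finite-volume power-law comparison of condensate numbers, uniform in the volume, which implies X_T
by the support glue ComparisonImpliesTransfer (proved sorry-free in the planner folder,
GlueCheck.lean).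
Lean: `(∀ v w : ℝ → ENNReal,
Literature.MathematicalPhysics.QuantumManyBody.BoseGas.IsRepulsiveFiniteRange v →
Literature.MathematicalPhysics.QuantumManyBody.BoseGas.IsRepulsiveFiniteRange w → (∃ M : NNReal, ∀
r, v r ≤ M) → Literature.MathematicalPhysics.QuantumManyBody.BoseGas.scatteringLength v =
Literature.MathematicalPhysics.QuantumManyBody.BoseGas.scatteringLength w → (∃ ρ₀ : ℝ, 0 < ρ₀ ∧ ∀ ρ
: ℝ, 0 < ρ → ρ < ρ₀ → Literature.MathematicalPhysics.QuantumManyBody.BoseGas.HasGroundStateBEC v ρ)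
→ ∃ ρ₀ : ℝ, 0 < ρ₀ ∧ ∀ ρ : ℝ, 0 < ρ → ρ < ρ₀ →
Literature.MathematicalPhysics.QuantumManyBody.BoseGas.HasGroundStateBEC w ρ) ∧ (∀ a : ℝ, 0 ≤ a → ∃
v : ℝ → ENNReal, Literature.MathematicalPhysics.QuantumManyBody.BoseGas.IsRepulsiveFiniteRange v ∧
(∃ M : NNReal, ∀ r, v r ≤ M) ∧
Literature.MathematicalPhysics.QuantumManyBody.BoseGas.scatteringLength v = ENNReal.ofReal a ∧ ∃ ρ₀
: ℝ, 0 < ρ₀ ∧ ∀ ρ : ℝ, 0 < ρ → ρ < ρ₀ →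
Literature.MathematicalPhysics.QuantumManyBody.BoseGas.HasGroundStateBEC v ρ)`

## Assembly
Pure logic plus two tree theorems: given admissible w,
`IsRepulsiveFiniteRange.scatteringLength_ne_top` (BoseGasThermodynamicLimitRuelle.lean, PROVED)
gives scatteringLength w ≠ ⊤; RepresentativeBEC at a := (scatteringLength w).toReal ≥ 0 yields a
bounded admissible v with scatteringLength v = ofReal a = scatteringLength w (ENNReal.ofReal_toReal)
and small-density BEC for v; ScatteringLengthTransfer v w closes the conjunct for w. Deciding
theorem (glue.lean, rc 0 in Sketch.lean, axioms propext/Classical.choice/Quot.sound): `theorem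
closes (h₁ : ScatteringLengthTransfer) (h₂ : RepresentativeBEC) : _root_.BoseEinsteinCondensation`.

Rationale: WHY THIS LINE. Mechanism (card equal-scattering-length-transfer; Jastrow
doi:10.1103/PhysRev.98.1479, Dyson1957, LSSY2005 proof of Thm 2.2 and App. C): at equal a the
zero-energy pair profiles f_v, f_w (tree: scatteringProfile / scatteringProfileLim) coincide beyond
the ranges, so the collision dressing D = Π_(i<j) (f_w/f_v)(x_i − x_j) is 1 unless a pair collides
and H_w(DΨ_v) = (E₀^v + Q)DΨ_v with the PAIR part of Q vanishing identically — Q is a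
collision-supported (≥3)-body term with an ordinary (no 1/k) hydrodynamic vertex, so the relative
corrector g = Ψ_w/(DΨ_v), the principal eigenfunction of the ground-state-transformed generator −L +
Q (Kipnis–Varadhan corrector language, KipnisVaradhan1986), should have O(1) one-particle
oscillation uniformly in N (card T1).
What gen-2 changes besides the conforming `closes`: the card's measure-theoretic step T2
(Hellinger-affinity transfer from a bounded one-particle oscillation of log dP^w_x/dP^v_x alone) is
WITHDRAWN — it is false as an abstract lemma (a dressing independent of the tagged particle can
re-weight the bath onto a v-rare region where v's Palm laws differ; explicit counterexample in the
planner's NOTES.md) — and replaced by the flatness-level reading: γ_w(x,y) ≍ e^(±2K) ρ_w(x)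
E_(P^w_x)[Ψ_v(y,·)/Ψ_v(x,·)], so what T1 must be paired with is CROSS-FLATNESS (the v-insertion
ratio is flat on w-TYPICAL baths), an input of landscape strength that is exactly the shared hinge
LandscapeBound at v = w; the honest shape is therefore "flatness of one constructive representative,
robust enough to survive the equal-a change of bath statistics, transfers", and the finite-volume
currency in which all of this is cashed is CondensateComparison.
Imported areas: Doob/ground-state transformation and corrector theory of reversible diffusions
(probability), Palm conditioning and Hellinger affinities of the one-particle marginals (measure
theory; the vocabulary GroundState.lean / OneParticleMarginals.lean requested by gen-1 has LANDED,
affinity representation γ = √(ρρ)·A(P_x,P_y) proved), zero-energy scattering ODE facts of the tree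
(scatteringLength_squareWell, odeScatteringLength); physics calibration: v-dependence of n₀ enters
only at relative order ρa³ (doi:10.1103/physreva.63.063609) and DMC sees hard and soft spheres of
equal a with equal energy AND condensate fraction at na³ ≲ 10⁻³ (GiorginiBoronatCasulleras1999); the
solved corner is GP scaling, where BEC holds for every v (LiebSeiringer2002, BoccatoEtAl2019).
What it does that other routes do not: it never bounds an energy to condensation precision
(BECInfraredBound, BECSectorPoincare*, BECPhononFloor live in the energy/gap currency), it turns
LSSY's printed question (LSSY2005 Ch. 2 after (2.13), PDF p. 16: the potential- and kinetic-energy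
dominated regimes of equal a, "whether they behave differently with respect to … Bose–Einstein
condensation is not known") into a theorem-shape with a finite-volume refutable core, and it hands
every method route (BECChargeConjugationRP already consumes X_T as stmt-9048; BECParentAnchor, RG /
cluster / RP cards) the softest admissible representative per a instead of ∀v; negatives index: no
BEC statement of this shape refuted (only stmt-3980, a sign loophole, unrelated).

RANKED CRUXES. #0 Thesis (target) — X = X_T ∧ X_R as in § Thesis (ScatteringLengthTransfer ∧
RepresentativeBEC, written out so that the decl elaborates ahead of the cruxes it names). (why it
might fail: X_R is thermodynamic-limit BEC for an interacting 3-D gas (open since 1947) restricted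
to one bounded potential per a; X_T is implied by the conjunct but has no proof that avoids a
landscape-strength input.) [LSSY2005, LiebSeiringer2002, GiorginiBoronatCasulleras1999]
#2 CondensateComparison (crux) — for admissible v (bounded) and w (arbitrary, hard cores allowed)
with scatteringLength v = scatteringLength w there are ρ₁, κ, C > 0 such that for ALL N ≥ 1 and L >
0 with N/L³ < ρ₁: condensateNumber w N L ≥ κ·N·(condensateNumber v N L / N)^C — the condensate
numbers (λ_max of the one-particle density matrix of the Dirichlet ground state, via
near-minimisers) of two equal-a gases are comparable by a power law uniformly in the volume (card T1
in typable, junk-free dress: both sides ≤ N, empty/jammed corners excluded by N/L³ < ρ₁(v,w)).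
[difficulty: XL] (why it might fail: Only known route to it is flatness transfer: log g (g =
Ψ_w/(DΨ_v), an extensive Feynman–Kac functional) needs N-uniform one-particle oscillation bounds AND
Ψ_v must stay flat on w-typical baths (= LandscapeBound at v = w); the card's affinity lemma T2 is
false; κ, C may drift with N.) [doi:10.1103/PhysRev.98.1479, Dyson1957, LSSY2005,
KipnisVaradhan1986, doi:10.1103/physreva.63.063609, GiorginiBoronatCasulleras1999, BoccatoEtAl2019]
#3 ScatteringLengthTransfer (crux) — X_T — for admissible v, w with v bounded and scatteringLength v
= scatteringLength w: (∃ ρ₀ > 0, ∀ ρ ∈ (0,ρ₀), HasGroundStateBEC v ρ) → (∃ ρ₀' > 0, ∀ ρ ∈ (0,ρ₀'),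
HasGroundStateBEC w ρ). Shared verbatim with stmt-AtomisticToContinuum-9048 (BECChargeConjugationRP
rank 7); hypothesis of `closes`; follows from CondensateComparison at L = (N/ρ)^(1/3) by
ComparisonImpliesTransfer, but may also be proved qualitatively. [deps: CondensateComparison]
[difficulty: XL] (why it might fail: False iff LSSY's open question (Ch. 2, PDF p. 16) resolves as
"hard- and soft-core gases of equal a differ w.r.t. BEC"; implied by the conjunct, so no cheap
refutation, and every proof idea in hand runs through the rank-2 comparison.) [LSSY2005,
LiebYngvason1998, GiorginiBoronatCasulleras1999,
Literature.Barriers.AtomisticToContinuum.EnergyAsymptoticsWithoutCondensation]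
#4 RepresentativeBEC (crux) — X_R — for every real a ≥ 0 there is a bounded admissible v with
scatteringLength v = ofReal a whose Dirichlet ground state has BEC at all small densities: the
conjunct for ONE representative per scattering length, prover's choice (square well K·1_[0,R] with a
= R − tanh(R√(K/2))/√(K/2) by scatteringLength_squareWell; Born height ε/R² for RG / cluster lines
via BornRepresentativesExist; positive type for RP / Lee–Yang lines; a = 0 is the free gas,
FreeGasZeroMode). [difficulty: open-problem] (why it might fail: It is thermodynamic-limit BEC for a
genuinely interacting 3-D dilute gas (open since 1947; rigorous BEC reaches boxes R ~
a(ρa³)^(−3/4−η) only, Junge2026): the sole gain is the free choice of one bounded v per a.)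
[LSSY2005, Fournais2020, Junge2026, FournaisSolovej2020,
Literature.Barriers.AtomisticToContinuum.KineticGapLengthScales]
#9 ComparisonImpliesTransfer (support) — glue of the foreseen split — CondensateComparison →
ScatteringLengthTransfer: at L = sideLength ρ N one has N/L³ = ρ (div_sideLength_pow_three), so for
ρ < min(ρ₀(v), ρ₁) the comparison turns ofReal (c N) ≤ condensateNumber v into ofReal (κ c^C N) ≤
condensateNumber w eventually in N (ENNReal.le_div_iff_mul_le, rpow_le_rpow, ofReal_rpow_of_pos).
Proved sorry-free in the planner folder (GlueCheck.lean, 30 lines) — to be re-landed in Theorems/.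
[difficulty: provable-now] [LSSY2005]
#9 BornRepresentativesExist (support) — existence half of RepresentativeBEC in the Born form (shared
verbatim with stmt-AtomisticToContinuum-9049): for ε > 0 and a ≥ 0 there is a bounded admissible v
of some range R with v ≤ ε/R² and scatteringLength v = a — the square well of height K = ε/R² on
[0,R] has a = R(1 − tanh Y/Y), Y = √(ε/2) (scatteringLength_squareWell), so R = a/(1 − tanh Y/Y); a
= 0 ↦ v = 0 (scatteringLength_zero). [difficulty: provable-now] [LSSY2005, FournaisEtAl2024]
#9 FreeGasZeroMode (support) — the a = 0 corner of RepresentativeBEC (shared verbatim with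
stmt-AtomisticToContinuum-8912): for admissible v a.e. zero on (0,∞) the Dirichlet gas is free and
every δ-near-minimiser (δ ~ L⁻²) has constant-mode occupation ≥ cN (gap 3π²/L², occupation (8/π²)³N
of the sine ground state); with occupation_le_maxOccupation + le_condensateNumber (sketched
sorry-free in Sketch.lean, representativeBEC_zero) and scatteringLength_zero this is
RepresentativeBEC at a = 0. [difficulty: M] [LSSY2005]

TWO-LAYER PLAN. Foreseen split of CondensateComparison (k = 3, depth 1) over the vocabulary that
landed for it (GroundState.lean: groundState, HasUniqueGroundState; OneParticleMarginals.lean: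
sliceMass, palmMeasure, affinity, densityMatrix; PeriodicBoseGasScatteringODE.lean:
scatteringProfile, scatteringProfileLim): CondensateComparison ⇐ RelativeCorrectorFlatness →
CrossFlatness → FlatnessToComparison → CondensateComparison, where RelativeCorrectorFlatness (card
T1): for bounded v, admissible w, equal a, N/L³ < ρ₁ and HasUniqueGroundState on both sides, the
w-bath average ∫ m_w(Y)·(PR_w(Y)/PR_v(Y))² dY ≤ K uniformly in N, L (PR_u(Y) =
L³∫Ψ_u(x,Y)²dx/(∫Ψ_u(x,Y)dx)² the participation ratio of the tagged slice, m_w the w-bath marginal);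
CrossFlatness: ∫ m_w(Y)·PR_v(Y)² dY ≤ K' (the v-representative's insertion amplitude stays flat on
w-typical baths); FlatnessToComparison: Cauchy–Schwarz gives ∫ m_w PR_w ≤ √(KK'), the groundState
form of LandscapeBound(w), then GroundStateRigidity / FlatModeFromLandscape / OccupationStability
(shared hinge items of BECCutLineWeakDisorder) and condensateNumber = maxOccupation(groundState)
under HasUniqueGroundState give CondensateComparison with C = 1. ScatteringLengthTransfer ⇐
ComparisonImpliesTransfer (filed). RepresentativeBEC ⇐ BornRepresentativesExist (filed) + BEC for
the chosen family — another route's crux restricted to the family (CornerTransfer of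
BECChargeConjugationRP, PinnedFlatnessGivesPeriodicBEC of BECParentAnchor + BoundaryTransferWeak
stmt-0827), attached by signature when a method route commits to a representative; a = 0 ⇐
FreeGasZeroMode (filed).

KILL CRITERIA. Refutation of ScatteringLengthTransfer (an admissible w without small-density BEC
while some bounded equal-a v condenses) closes the route `refuted:ScatteringLengthTransfer` — and
settles LSSY's question negatively, a result in itself. Refutation of CondensateComparison alone (κ,
C provably N-dependent for some equal-a pair, e.g. by Dirichlet boundary depletion at N fixed, L →
∞) forces a pivot: restate rank 2 in its eventually-in-N form along L = (N/ρ)^(1/3) (the torus form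
if BoundaryTransferWeak lands) and keep the assembly. A proof that RelativeCorrectorFlatness needs
CrossFlatness of full LandscapeBound strength for every representative demotes the line to its
rigidity corollary; then close `superseded` in favour of the method route proving a landscape bound
for one representative. RepresentativeBEC refuted means the conjunct fails for every bounded
potential of some scattering length and kills every route of the sub-problem.

NOT DECOMPOSED YET. The corrector machinery — the pair-neutral identity H_w(DΨ_v) = (E₀^v + Q)DΨ_v
as a lemma over scatteringProfile, the h-transformed generator L, the (≥3)-body remainder Q as a
function on configuration space, the cumulant expansion of log g in the collision density ρR³ — is
layer 2 under CondensateComparison (Two-layer plan); the identification condensateNumber =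
maxOccupation(groundState) under HasUniqueGroundState (compactness of near-minimisers: Rellich on
Λ_L^N, absent from Mathlib) is a hinge shared with the Palm/landscape routes and is filed by
whichever splits first; the hard-core contact analysis (w with cores: D vanishes in the core, ∇log
f_w singular at contact) only if provers ask; the choice of representative family inside
RepresentativeBEC is deliberately left to whichever method route attaches; the d = 1, 2 consistency
remarks (the same dressing transfers absence of BEC) stay informal; no negative statement is filed.

CHEAPEST FALSIFIER. (i) DONE by the planner (paper, NOTES.md): the card's affinity-transfer lemma T2
is false — Ω = [0,1], P_x = (1−η)·Unif + η·Unif(I_x) with disjoint bumps I_x of size b, dressing R =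
c·1_(∪I_x): oscillation 0, BC(P_x,P_y) ≥ 1 − η yet BC(RP_x, RP_y) ≤ β/η + 2b/η + 2√(b/η) → 0 — so
refuters should attack CondensateComparison directly, not T2. (ii) N = 3, 4, 6 bosons in a Dirichlet
or periodic cube with two bounded potentials of equal a (Gaussian core vs square well matched
through odeScatteringLength / scatteringLength_squareWell): compute Ψ_v, Ψ_w on a grid or by DMC,
check that H_w(DΨ_v) − E₀^v DΨ_v is supported on double collisions and that osc_x log g = O(ρR³)
without growth in N; and the uniformity corner of CondensateComparison: N = 2…6 fixed, L → ∞ (is 1 −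
condensateNumber/N = O(a/L) for both?). (iii) Literature check DONE: GiorginiBoronatCasulleras1999 —
hard and soft spheres (R = 5a, 10a) of equal a have equal E/N and n₀/N within error bars for na³ ≲
10⁻³; doi:10.1103/physreva.63.063609 — first non-universal correction at relative order ρa³; a
documented O(√(ρa³)) discrepancy between equal-a potentials would have killed the line.

NUMBERS. Energy: e₀(ρ) = 4πρa(1 + (128/15√π)√(ρa³) + o(√(ρa³))) for every admissible v (LSSY2005 Thm
2.1; FournaisSolovej2020, FournaisSolovej2022 incl. hard cores), so E₀^w − E₀^v = N·o(ρa√(ρa³)),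
heuristically N·O(ρ²a²R). Depletion (Bogoliubov): 1 − n₀/N = (8/3√π)√(ρa³) + O(ρa³ log(ρa³)),
universal in a to that order (LSSY2005 App. A); v-dependence from O(ρa³) on
(doi:10.1103/physreva.63.063609). DMC (GiorginiBoronatCasulleras1999): HS vs SS-5, SS-10
indistinguishable in E/N and n₀/N for na³ ≤ 10⁻³. Rigorous BEC to date: boxes of side R ~
a(ρa³)^(−3/4−η), T ~ ρa (Junge2026 Cor. 6; Fournais2020). Square-well representative: a = R −
tanh(R√(K/2))/√(K/2) (scatteringLength_squareWell; e.g. R = 2a needs tanh y = y/2, y ≈ 1.915).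
Collision smallness per particle: ρR³·(a/R). Items at open: 8 (1 target, 3 cruxes, 3 supports, 1
assembly).

DEFINITION REQUESTS. None new: the gen-1 request `groundState` LANDED as
Literature/MathematicalPhysics/QuantumManyBody/GroundState.lean + OneParticleMarginals.lean
(fact-free), which types the layer-2 children; no cite facts requested — no unproved named
Literature fact is a hypothesis of any item (the import cone is definitions plus the PROVED
IsRepulsiveFiniteRange.scatteringLength_ne_top used inside `closes`).

Novelty: Searches (2026-08-15, this seat): `lit search --hybrid "condensate fraction universality scattering
length hard sphere soft sphere dilute Bose gas ground state"` (15 book hits: LSSY2005 pp. 11/16,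
Pethick–Smith, Griffin, Griffin–Snoke–Stringari — energy universality and Bogoliubov depletion
only); `lit search --source crossref "nonuniversal effects homogeneous Bose gas condensate"` (10; →
doi:10.1103/physreva.63.063609); `lit search --source crossref "ground state homogeneous Bose gas
diffusion Monte Carlo hard sphere soft sphere condensate fraction"` (10; →
GiorginiBoronatCasulleras1999, Dyson1957); `lit search --source crossref "complete Bose-Einstein
condensation Gross-Pitaevskii regime box optimal rate" --year-from 2018` (8: BoccatoEtAl2019,
Adhikari–Brennecke–Schlein 2020, Brennecke–Brooks–Caraci–Oldenburg 2024 — GP scaling and slightly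
beyond, every v); `lit search --source arxiv "Bose Einstein condensation transfer between potentials
equal scattering length ground state ratio"` (0); `lit search --source zbmath` ×2 (0, 0); `lit
galaxy search "same scattering length" --star all` (40 rows: Pathria, Huang, Hansen–McDonald,
cold-atom EFT arXiv:1001.5071, Carlen–Holzmann–Jauslin–Lieb simple-equation numerics — none on
order-parameter transfer); `lit frontier AtomisticToContinuum --since 2022` (30 rows; Junge2026 ×2,
trial-state notes: Neumann/kinetic localisation, energy currency); `lit bridges AtomisticToContinuum
--cross any` (nothing on BEC universality); `lit read LSSY20  [refs: 10.1103/physreva.63.063609, 10.1103/PhysRev.98.1479, 1001.5071, doi:10.1103/physreva.63.063609, doi:10.1103/PhysRev.98.1479, LSSY2005, GiorginiBoronatCasulleras1999, Dyson1957, BoccatoEtAl2019, Junge2026, LiebSeiringer2002, KipnisVaradhan1986]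

Barriers (technique_class: universality-transfer ground-state-ratio neutral-corrector): - technique_class: universality-transfer ground-state-ratio neutral-corrector
- Literature.Barriers.AtomisticToContinuum.EnergyAsymptoticsWithoutCondensation: answered in shape
rather than evaded — no energy asymptotics certify condensation here; E₀^w − E₀^v enters only as the
principal eigenvalue normalising g; X_T is the theorem-shape of the very question this barrier file
quotes (LSSY2005 Ch. 2, PDF p. 16).
- Literature.Barriers.AtomisticToContinuum.KineticGapLengthScales: not invoked — no Poincaré / gap
inequality at scale L; the corrector bound is claimed UV-dominated (vertex of Q without 1/k, bounded
static response); the bet is that CrossFlatness for a constructive representative is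
configuration-robust; if the cumulant expansion of log g secretly needs a gap ~ L⁻², the barrier
bites and rank 2 stalls at the Junge2026 scale a(ρa³)^(−3/4).
- Literature.Barriers.AtomisticToContinuum.BogoliubovPerturbationInfrared: the d = 3 marginal
logarithms sit in log Ψ_v and log Ψ_w separately; only their RATIO is expanded, whose soft parts
cancel to leading order at equal a (equal sound speed to relative O(√(ρa³))); it does not evade the
barrier for CrossFlatness, which carries the full infrared of the landscape — the bet is that it is
paid once, for the softest representative.
- Literature.Barriers.AtomisticToContinuum.OneDimensionalHardCore: consistent rather than evaded —
the transfer is dimension-blind and would carry no-BEC to no-BEC in d = 1 (Lieb–Liniger universality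
in the 1

History (route lifecycle, newest last):
- 2026-08-25T13:18:59Z · DORMANT — reconciler: no traction for 7.7 d (last activity item-evidence-added at 2026-08-17T19:15:47Z); parked, not closed — `ledger route dormant route-AtomisticToConti (operator:999:1590395)
- 2026-08-29T07:03:46Z · REACTIVATED — reconciler: reactivated — activity statement-checked at 2026-08-29T05:25:28Z after parking at 2026-08-25T13:18:59Z (operator:999:2446489)
- 2026-09-03T10:19:02Z · DORMANT — reconciler: no traction for 5 d (last activity statement-checked at 2026-08-29T09:16:14Z); parked, not closed — `ledger route dormant route-AtomisticToContinuum (operator:999:373593)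

sub-problem: BoseEinsteinCondensation · status: dormant · opened planner-plancard-AtomisticToContinuum-BoseEin-d147e66c-g2-0 2026-08-15T18:55:22Z · rev 4 · ledger route-AtomisticToContinuum-BECEqualScatteringTransfer
GENERATED by the gate from the ledger (D-0016/17). Provers cite these decls: `theorem foo : Summit.AtomisticToContinuum.BoseEinsteinCondensation.Theses.BECEqualScatteringTransfer.<Decl> := …` in Summits/AtomisticToContinuum/BoseEinsteinCondensation/Theorems/<Name>.lean.
-/

namespace Summit.AtomisticToContinuum.BoseEinsteinCondensation.Theses.BECEqualScatteringTransfer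

open scoped BigOperators Topology Manifold Classical MeasureTheory ProbabilityTheory Matrix InnerProductSpace ComplexConjugate ContinuousMap
open Filter Set Function TopologicalSpace MeasureTheory

attribute [summit_statement] _root_.BoseEinsteinCondensation

/-- item stmt-AtomisticToContinuum-12536 · target · rank 0 · open · by planner
why it might fail: X_R is thermodynamic-limit BEC for an interacting 3-D gas (open since 1947) restricted to one bounded potential per a; X_T is implied by the conjunct but has no proof that avoids a landscape-strength input.
sources: LSSY2005, LiebSeiringer2002, GiorginiBoronatCasulleras1999
[target] X = X_T ∧ X_R as in § Thesis (ScatteringLengthTransfer ∧ RepresentativeBEC, written out so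
that the decl elaborates ahead of the cruxes it names). -/
@[route_item "route-AtomisticToContinuum-BECEqualScatteringTransfer"]
def Thesis : Prop :=
  (∀ v w : ℝ → ENNReal, Literature.MathematicalPhysics.QuantumManyBody.BoseGas.IsRepulsiveFiniteRange v → Literature.MathematicalPhysics.QuantumManyBody.BoseGas.IsRepulsiveFiniteRange w → (∃ M : NNReal, ∀ r, v r ≤ M) → Literature.MathematicalPhysics.QuantumManyBody.BoseGas.scatteringLength v = Literature.MathematicalPhysics.QuantumManyBody.BoseGas.scatteringLength w → (∃ ρ₀ : ℝ, 0 < ρ₀ ∧ ∀ ρ : ℝ, 0 < ρ → ρ < ρ₀ → Literature.MathematicalPhysics.QuantumManyBody.BoseGas.HasGroundStateBEC v ρ) → ∃ ρ₀ : ℝ, 0 < ρ₀ ∧ ∀ ρ : ℝ, 0 < ρ → ρ < ρ₀ → Literature.MathematicalPhysics.QuantumManyBody.BoseGas.HasGroundStateBEC w ρ) ∧ (∀ a : ℝ, 0 ≤ a → ∃ v : ℝ → ENNReal, Literature.MathematicalPhysics.QuantumManyBody.BoseGas.IsRepulsiveFiniteRange v ∧ (∃ M : NNReal, ∀ r, v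 r ≤ M) ∧ Literature.MathematicalPhysics.QuantumManyBody.BoseGas.scatteringLength v = ENNReal.ofReal a ∧ ∃ ρ₀ : ℝ, 0 < ρ₀ ∧ ∀ ρ : ℝ, 0 < ρ → ρ < ρ₀ → Literature.MathematicalPhysics.QuantumManyBody.BoseGas.HasGroundStateBEC v ρ)

/-- item stmt-AtomisticToContinuum-12537 · crux · rank 2 · open · by planner
why it might fail: Only known route to it is flatness transfer: log g (g = Ψ_w/(DΨ_v), an extensive Feynman–Kac functional) needs N-uniform one-particle oscillation bounds AND Ψ_v must stay flat on w-typical baths (= LandscapeBound at v = w); the card's affinity lemma T2 is false; κ, C may drift with N.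
sources: doi:10.1103/PhysRev.98.1479, Dyson1957, LSSY2005, KipnisVaradhan1986, doi:10.1103/physreva.63.063609, GiorginiBoronatCasulleras1999
[crux] for admissible v (bounded) and w (arbitrary, hard cores allowed) with scatteringLength v =
scatteringLength w there are ρ₁, κ, C > 0 such that for ALL N ≥ 1 and L > 0 with N/L³ < ρ₁:
condensateNumber w N L ≥ κ·N·(condensateNumber v N L / N)^C — the condensate numbers (λ_max of the
one-particle density matrix of the Dirichlet ground state, via near-minimisers) of two equal-a gases
are comparable by a power law uniformly in the volume (card T1 in typable, junk-free dress: both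
sides ≤ N, empty/jammed corners excluded by N/L³ < ρ₁(v,w)). [difficulty: XL] -/
@[route_item "route-AtomisticToContinuum-BECEqualScatteringTransfer"]
def CondensateComparison : Prop :=
  ∀ v w : ℝ → ENNReal, Literature.MathematicalPhysics.QuantumManyBody.BoseGas.IsRepulsiveFiniteRange v → Literature.MathematicalPhysics.QuantumManyBody.BoseGas.IsRepulsiveFiniteRange w → (∃ M : NNReal, ∀ r, v r ≤ M) → Literature.MathematicalPhysics.QuantumManyBody.BoseGas.scatteringLength v = Literature.MathematicalPhysics.QuantumManyBody.BoseGas.scatteringLength w → ∃ ρ₁ κ C : ℝ, 0 < ρ₁ ∧ 0 < κ ∧ 0 < C ∧ ∀ (N : ℕ) (L : ℝ), 0 < N → 0 < L → (N : ℝ) / L ^ 3 < ρ₁ → ENNReal.ofReal κ * N * (Literature.MathematicalPhysics.QuantumManyBody.BoseGas.condensateNumber v N L / N) ^ C ≤ Literature.MathematicalPhysics.QuantumManyBody.BoseGas.condensateNumber w N L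

/-- item stmt-AtomisticToContinuum-9048 · crux · rank 3 · open · by planner
why it might fail: False iff LSSY's open question (Ch. 2, PDF p. 16) resolves as "hard- and soft-core gases of equal a differ w.r.t. BEC"; implied by the conjunct, so no cheap refutation, and every proof idea in hand runs through the rank-2 comparison.
sources: LSSY2005, LiebYngvason1998, GiorginiBoronatCasulleras1999, Literature.Barriers.AtomisticToContinuum.EnergyAsymptoticsWithoutCondensation
[crux] shared verbatim with route EqualScatteringTransfer (stmt-AtomisticToContinuum-4285): for
admissible v (bounded) and w with equal scattering length, small-density Dirichlet BEC transfers
from v to w — here it carries the Born-regime corner to every admissible potential, hard cores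
included. [difficulty: XL] -/
@[route_item "route-AtomisticToContinuum-BECEqualScatteringTransfer"]
def ScatteringLengthTransfer : Prop :=
  ∀ v w : ℝ → ENNReal, Literature.MathematicalPhysics.QuantumManyBody.BoseGas.IsRepulsiveFiniteRange v → Literature.MathematicalPhysics.QuantumManyBody.BoseGas.IsRepulsiveFiniteRange w → (∃ M : NNReal, ∀ r, v r ≤ M) → Literature.MathematicalPhysics.QuantumManyBody.BoseGas.scatteringLength v = Literature.MathematicalPhysics.QuantumManyBody.BoseGas.scatteringLength w → (∃ ρ₀ : ℝ, 0 < ρ₀ ∧ ∀ ρ : ℝ, 0 < ρ → ρ < ρ₀ → Literature.MathematicalPhysics.QuantumManyBody.BoseGas.HasGroundStateBEC v ρ) → ∃ ρ₀ : ℝ, 0 < ρ₀ ∧ ∀ ρ : ℝ, 0 < ρ → ρ < ρ₀ → Literature.MathematicalPhysics.QuantumManyBody.BoseGas.HasGroundStateBEC w ρ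

/-- item stmt-AtomisticToContinuum-12538 · crux · rank 4 · open · by planner
why it might fail: It is thermodynamic-limit BEC for a genuinely interacting 3-D dilute gas (open since 1947; rigorous BEC reaches boxes R ~ a(ρa³)^(−3/4−η) only, Junge2026): the sole gain is the free choice of one bounded v per a.
sources: LSSY2005, Fournais2020, Junge2026, FournaisSolovej2020, Literature.Barriers.AtomisticToContinuum.KineticGapLengthScales
[crux] X_R — for every real a ≥ 0 there is a bounded admissible v with scatteringLength v = ofReal a
whose Dirichlet ground state has BEC at all small densities: the conjunct for ONE representative per
scattering length, prover's choice (square well K·1_[0,R] with a = R − tanh(R√(K/2))/√(K/2) by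
scatteringLength_squareWell; Born height ε/R² for RG / cluster lines via BornRepresentativesExist;
positive type for RP / Lee–Yang lines; a = 0 is the free gas, FreeGasZeroMode). [difficulty:
open-problem] -/
@[route_item "route-AtomisticToContinuum-BECEqualScatteringTransfer"]
def RepresentativeBEC : Prop :=
  ∀ a : ℝ, 0 ≤ a → ∃ v : ℝ → ENNReal, Literature.MathematicalPhysics.QuantumManyBody.BoseGas.IsRepulsiveFiniteRange v ∧ (∃ M : NNReal, ∀ r, v r ≤ M) ∧ Literature.MathematicalPhysics.QuantumManyBody.BoseGas.scatteringLength v = ENNReal.ofReal a ∧ ∃ ρ₀ : ℝ, 0 < ρ₀ ∧ ∀ ρ : ℝ, 0 < ρ → ρ < ρ₀ → Literature.MathematicalPhysics.QuantumManyBody.BoseGas.HasGroundStateBEC v ρ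

/-- item stmt-AtomisticToContinuum-12539 · support · rank 9 · open · by planner
sources: LSSY2005
[support] glue of the foreseen split — CondensateComparison → ScatteringLengthTransfer: at L =
sideLength ρ N one has N/L³ = ρ (div_sideLength_pow_three), so for ρ < min(ρ₀(v), ρ₁) the comparison
turns ofReal (c N) ≤ condensateNumber v into ofReal (κ c^C N) ≤ condensateNumber w eventually in N
(ENNReal.le_div_iff_mul_le, rpow_le_rpow, ofReal_rpow_of_pos). Proved sorry-free in the planner
folder (GlueCheck.lean, 30 lines) — to be re-landed in Theorems/. [difficulty: provable-now] -/
@[route_item "route-AtomisticToContinuum-BECEqualScatteringTransfer"]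
def ComparisonImpliesTransfer : Prop :=
  CondensateComparison → ScatteringLengthTransfer

/-- item stmt-AtomisticToContinuum-14111 · support · rank 9 · open · by planner
sources: LSSY2005
[support] [glue] target glue — the two cruxes named in the thesis give the target X = X_T ∧ X_R:
`Thesis` is by definition the conjunction of the bodies of ScatteringLengthTransfer (X_T) and
RepresentativeBEC (X_R), so the proof is `fun h₁ h₂ => ⟨h₁, h₂⟩` (checked rc 0 against the route
module in the planner folder, Sketch.lean); filed so that the target is reachable in the item graph
(gate stamp route.target-unreachable). Together with `closes` (ScatteringLengthTransfer →
RepresentativeBEC → BoseEinsteinCondensation) this gives both frame edges. [deps: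
ScatteringLengthTransfer, RepresentativeBEC] [difficulty: provable-now] -/
@[route_item "route-AtomisticToContinuum-BECEqualScatteringTransfer"]
def ThesisOfCruxes : Prop :=
  ScatteringLengthTransfer → RepresentativeBEC → Thesis

/-- item stmt-AtomisticToContinuum-8912 · support · rank 9 · closed · proved by Summit.AtomisticToContinuum.BoseEinsteinCondensation.Theorems.BecFreeGas_proof @ bfb6be804c6f (prover) · by planner
sources: LSSY2005
[support] FREE-GAS CASE (new; refuters g12-5/g28-0 knock-on): for every repulsive finite-range v
that IS a.e. zero on (0,∞) the interaction term vanishes a.e. on configuration space (pair-distance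
level sets of a null set are null), so energy = kinetic: the free Dirichlet gas. Then X_B1 for v: E₀
= 3Nπ²/L² (sharp Poincaré on (0,L)), gap 3π²/L² to the first excited level, so a δ-near-minimiser
with δ ≤ η²·3π²/L² is L²-within η of e^(iα)χ^⊗N, χ = ∏_j (2/L)^(1/2) sin(πx_j/L);
√occupation(φ₀,·)/√N is 1-Lipschitz in L², and occupation(φ₀, χ^⊗N) = N·|⟨L^(-3/2), χ⟩|² = (8/π²)³N
≈ 0.533N, whence ⟨φ₀,γ_Ψφ₀⟩ ≥ N/4 for η small: c = 1/4, any ρ₀. Provable now; Lean-heavy (1-D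
Wirtinger/Poincaré with sharp constant, tensorisation, explicit sine integrals). [difficulty: M]
[sources: LSSY2005] -/
@[route_item "route-AtomisticToContinuum-BECEqualScatteringTransfer"]
def FreeGasZeroMode : Prop :=
  ∀ v : ℝ → ENNReal, Literature.MathematicalPhysics.QuantumManyBody.BoseGas.IsRepulsiveFiniteRange v → (∀ᵐ r ∂(MeasureTheory.volume.restrict (Set.Ioi (0 : ℝ))), v r = 0) → ∃ ρ₀ : ℝ, 0 < ρ₀ ∧ ∀ ρ : ℝ, 0 < ρ → ρ < ρ₀ → ∃ c : ℝ, 0 < c ∧ ∀ᶠ N : ℕ in Filter.atTop, ∃ δ : ENNReal, 0 < δ ∧ ∀ Ψ : Literature.MathematicalPhysics.QuantumManyBody.BoseGas.TrialState N (Literature.MathematicalPhysics.QuantumManyBody.BoseGas.sideLength ρ N), Literature.MathematicalPhysics.QuantumManyBody.BoseGas.energy v Ψ ≤ Literature.MathematicalPhysics.QuantumManyBody.BoseGas.groundStateEnergy v N (Literature.MathematicalPhysics.QuantumManyBody.BoseGas.sideLength ρ N) + δ → ENNReal.ofReal (c * N) ≤ Literature.MathematicalPhysics.QuantumManyBody.BoseGas.occupation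 N ((Literature.MathematicalPhysics.QuantumManyBody.BoseGas.box (Literature.MathematicalPhysics.QuantumManyBody.BoseGas.sideLength ρ N)).indicator fun _ => ((Real.sqrt (Literature.MathematicalPhysics.QuantumManyBody.BoseGas.sideLength ρ N ^ 3))⁻¹ : ℂ)) Ψ.ψ

/-- `FreeGasZeroMode` holds: proved by `Summit.AtomisticToContinuum.BoseEinsteinCondensation.Theorems.BecFreeGas_proof` @ bfb6be804c6f. -/
theorem FreeGasZeroMode_holds : FreeGasZeroMode := _root_.Summit.AtomisticToContinuum.BoseEinsteinCondensation.Theorems.BecFreeGas_proof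

/-- item stmt-AtomisticToContinuum-9049 · support · rank 9 · closed · proved by Summit.AtomisticToContinuum.BoseEinsteinCondensation.Theorems.bornRepresentativesExist_proof (prover) · by planner
sources: LSSY2005, FournaisEtAl2024
[support] every scattering length has a Born-regime representative: for ε > 0 and a ≥ 0 there is a
bounded admissible v of some range R with v ≤ ε/R² and scatteringLength v = a (top hat of height
ε/R² on [0,R]: a = R(1 − tanh Y/Y), Y = √(ε/2), so R = a/(1 − tanh Y/Y); a = 0 ↦ v = 0,
scatteringLength_zero), over the tree's odeScatteringLength facts. [difficulty: M] -/
@[route_item "route-AtomisticToContinuum-BECEqualScatteringTransfer"]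
def BornRepresentativesExist : Prop :=
  ∀ ε : ℝ, 0 < ε → ∀ a : ℝ, 0 ≤ a → ∃ v : ℝ → ENNReal, Literature.MathematicalPhysics.QuantumManyBody.BoseGas.IsRepulsiveFiniteRange v ∧ (∃ M : NNReal, ∀ r, v r ≤ M) ∧ (∃ R : ℝ, 0 < R ∧ (∀ r, R < r → v r = 0) ∧ ∀ r, v r ≤ ENNReal.ofReal (ε / R ^ 2)) ∧ Literature.MathematicalPhysics.QuantumManyBody.BoseGas.scatteringLength v = ENNReal.ofReal a

/-- `BornRepresentativesExist` holds: proved by `Summit.AtomisticToContinuum.BoseEinsteinCondensation.Theorems.bornRepresentativesExist_proof`. -/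
theorem BornRepresentativesExist_holds : BornRepresentativesExist := _root_.Summit.AtomisticToContinuum.BoseEinsteinCondensation.Theorems.bornRepresentativesExist_proof

/-- item stmt-AtomisticToContinuum-12540 · assembly · rank 1 · open · by planner
sources: LSSY2005
[assembly] ScatteringLengthTransfer → RepresentativeBEC → BoseEinsteinCondensation (the sub-problem
decl `_root_.BoseEinsteinCondensation`; literally the type of `closes`). -/
@[route_item "route-AtomisticToContinuum-BECEqualScatteringTransfer"]
def Assembly : Prop :=
  ScatteringLengthTransfer → RepresentativeBEC → _root_.BoseEinsteinCondensation

/-! D-0027 §2.1 — DECIDING THEOREM (planner-authored via `route open/edit --closes-file`; by planner-plancard-AtomisticToContinuum-BoseEin-d147e66c-g2-0 2026-08-15T18:55:22Z):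
its hypotheses are this route's items and its conclusion the sub-problem Statement (glue_lint), and it elaborates with this file. -/

@[closes "route-AtomisticToContinuum-BECEqualScatteringTransfer"] theorem closes (h₁ : ScatteringLengthTransfer) (h₂ : RepresentativeBEC) : _root_.BoseEinsteinCondensation := by
  intro w hw
  obtain ⟨v, hv, hvM, hva, hbec⟩ := h₂ _
    (ENNReal.toReal_nonneg (a := Literature.MathematicalPhysics.QuantumManyBody.BoseGas.scatteringLength w))
  exact h₁ v w hv hw hvM
    (by rw [hva, ENNReal.ofReal_toReal
      (Literature.MathematicalPhysics.QuantumManyBody.BoseGas.IsRepulsiveFiniteRange.scatteringLength_ne_top hw)])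
    hbec

end Summit.AtomisticToContinuum.BoseEinsteinCondensation.Theses.BECEqualScatteringTransfer
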